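/-
Copyright (c) 2026 the pub-hodgecm-mathlib formalisation cell (harness21).  Prover seat hodgecm-mathlib-LH4-p08 (g2), req620 Track A «(D-RAM) FOUR-FRAME» squad
(heir LEAD F0P3a-plan (g19) (R-17) «NI2 ⊕ MS»; dealer LH4-plan (g10); MS ROAD-A TARGET J of LH4-p11 (g0) 2026-09-03T22:46:06Z, second seat of (MS)).  2026-09-03.
-/
import Summits.HodgeConjecture.HodgeConjecture.Theorems.F0P3cDyRamLattRowIdeal   -- ★ p855324 row ideal; brings ★ `UnitaryLatticeTreeDual`∕`Defs` (`latt`, `mapGL`, `mulVec_single_mem_latt`)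
import HarnessLib

/-!
# Crux `H413`, line LH4 «(D-RAM) FOUR-FRAME» road — unit U3_Laws (iii), (R-17) MS ROAD A, TIER 2 SUPPORT: «NORMALISATION SECTION» — every `ϖ^{ℤ^N}`-orbit of a
# full lattice `latt g` meets the NORMALISED set (`pr_i M = 𝒪` for all `i`) exactly once

Cell `hodgecm-mathlib` (D-0151), FLOOR 0, crux item H413 = `stmt-HodgeConjecture-24833`, route of record `HCCMUnconditional`; squad F0∕P3c∕LH4 (req618∕req620).  THEOREMS ONLY
(no `def`, no instance, no notation, no `sorry`, default heartbeats); lane `--supports stmt-HodgeConjecture-24833 --as helper` (count-neutral).  MS ROAD-A TARGET J of LH4-p11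
(g0)'s list for the (S-fin) reduction of LH4-p10 (g0) (MEMO `F0/P3c/LH4/LH4-p10/g0/MEMO-stableLaw-finite.v1.LH4p10g0.md` §2 (3)(e): «the orbit `T(E)·M` modulo the free
`ϖ^{ℤ³}`-action has `[𝒯 : S̃]` normalised members» starts with: every `ϖ^{ℤ³}`-orbit of a lattice meets the normalised set exactly once), statement BY SIGNATURE as worded on the
squad bus 2026-09-03T22:46:06Z, def-free spelling (the diagonal matrix `diag(ϖ^{a_i})` is quantified as a `GL`-element `Z` with prescribed entries).

THE MATHEMATICS.  For `g ∈ GL_N(K)` the `i`-th coordinate ideal of `M = latt g = g·𝒪^N` is `pr_i(M) = 𝒪 · (max_j |g_{ij}|)` (★ p855324 `F0P3cDyRamLattRowIdeal`: bound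
`v_apply_le_sup_of_mem_latt'` + attainment `exists_mem_latt_v_apply_eq_sup'`), and `max_j |g_{ij}| = exp(r_i) ≠ 0` for a unique `r_i ∈ ℤ` because an invertible matrix has no
zero row and the value monoid is `ℤᵐ⁰`.  For `Z = diag(ϖ^{a})` one has `Z·latt g = latt (Z g)` with rows `ϖ^{a_i} g_{i·}`, so `pr_i(Z·M) = 𝒪 · exp(r_i − a_i)` (`|ϖ| = exp(−1)`):
the translate is normalised at slot `i` (`pr_i = 𝒪`, i.e. all `|x_i| ≤ 1` and some `|x_i| = 1`) iff `a_i = r_i`.  Hence `a = r` is the UNIQUE normalising exponent vector —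
`𝓛 ∕ ϖ^{ℤ^N} ≅ 𝓛₀` (the normalised set, parametrised at `N = 3` by the HNF model of ★ p855280∕p855304), the first identification in the orbit count (3c-iii).

WHAT IS PROVED (generic valued field `K` with `Valued K ℤᵐ⁰`, any `N`; no `σ`, no form, no completeness):
* §1 `exists_row_exponent` — each row of `g ∈ GL_N(K)` has a max valuation `exp(r_i)`, attained; `exists_gl_coe_eq_diagonal_zpow` — `diag(ϖ^{a})` is a `GL`-element (`ϖ ≠ 0`).
* §2 `mapGL_latt_eq_latt_diagonal_mul`, `v_apply_le_of_mem_mapGL_diagonal`, `exists_mem_mapGL_diagonal_v_apply_eq` — `pr_i(diag(z)·latt g) = z_i · pr_i(latt g)` as a bound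
  + attainment pair; `normalisedAt_mapGL_diagonal_zpow_iff` — slot `i` of `diag(ϖ^{a})·latt g` is normalised iff `exp(a_i) = max_j |g_{ij}|` (as the bound∕attainment pair).
* §3 HEAD **`existsUnique_zpow_diagonal_normalised`** — TARGET J verbatim: `∃! a : Fin N → ℤ, ∀ Z = diag(ϖ^{a}), ∀ i, (∀ x ∈ Z·latt g, |x_i| ≤ 1) ∧ ∃ x ∈ Z·latt g, |x_i| = 1`.
HONEST LABEL.  Count-neutral; nothing printed is asserted; the census laws stay PROVER TARGETS; `HC_CM` is proved only modulo the 7 printed citations (2 remaining named inputs: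
hLiu418 = `stmt-HodgeConjecture-24832`, h413 = `stmt-HodgeConjecture-24833`) until rung 0 closes.

## References
* [Serre1980Trees] J.-P. Serre, *Trees*, Springer (1980), Ch. II §1.1 (lattices `g·𝒪^N`, lattice classes modulo scalars; here modulo the split torus `ϖ^{ℤ^N}`).
* [BruhatTits1972] F. Bruhat, J. Tits, *Groupes réductifs sur un corps local I*, Publ. Math. IHÉS 41 (1972), §10 (apartment of the diagonal torus: vertices `diag(ϖ^{a})·𝒪^N`).
-/

set_option autoImplicit false

noncomputable section

namespace Summit.HodgeConjecture.HodgeConjecture.Cruxes.H413.F0P3cDyRamDiagonalNormalisedSection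

open Matrix
open Literature.NumberTheory.Automorphic Literature.NumberTheory.Automorphic.HermitianLattice
open Literature.NumberTheory.Automorphic.UnitaryLatticeTree
open Summit.HodgeConjecture.HodgeConjecture.Cruxes.H413.F0P3cDyRamLattRowIdeal
open scoped Valued WithZero Matrix MatrixGroups

variable {K : Type*} [Field K] [Valued K ℤᵐ⁰] {N : ℕ}

/-! ## §1 Row exponents of an invertible matrix; the diagonal `ϖ`-powers as `GL`-elements -/

/-- **Row exponents.** Each row `i` of `g ∈ GL_N(K)` has a maximal entry valuation `max_j |g_{ij}| = exp(r_i)` for some `r_i ∈ ℤ`, and the maximum is attained: an invertible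
matrix has no zero row, and every non-zero element of `ℤᵐ⁰` is an `exp`. [cite: Serre1980Trees, II §1.1] -/
theorem exists_row_exponent (g : GL (Fin N) K) (i : Fin N) :
    ∃ r : ℤ, (∀ j, Valued.v ((g : Matrix (Fin N) (Fin N) K) i j) ≤ WithZero.exp r) ∧ ∃ j, Valued.v ((g : Matrix (Fin N) (Fin N) K) i j) = WithZero.exp r := by
  haveI : Nonempty (Fin N) := ⟨i⟩
  obtain ⟨j₀, -, hj₀⟩ := Finset.exists_max_image Finset.univ (fun j => Valued.v ((g : Matrix (Fin N) (Fin N) K) i j)) Finset.univ_nonempty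
  have hne : Valued.v ((g : Matrix (Fin N) (Fin N) K) i j₀) ≠ 0 := by
    intro h0
    have hdet : IsUnit (g : Matrix (Fin N) (Fin N) K).det := (Matrix.isUnit_iff_isUnit_det _).1 g.isUnit
    refine hdet.ne_zero (Matrix.det_eq_zero_of_row_eq_zero i fun j => ?_)
    have hj := hj₀ j (Finset.mem_univ j)
    rw [h0, le_zero_iff] at hj
    exact (Valuation.zero_iff _).1 hj
  refine ⟨WithZero.log (Valued.v ((g : Matrix (Fin N) (Fin N) K) i j₀)), fun j => ?_, j₀, ?_⟩
  · rw [WithZero.exp_log hne]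
    exact hj₀ j (Finset.mem_univ j)
  · rw [WithZero.exp_log hne]

omit [Valued K ℤᵐ⁰] in
/-- **`diag(ϖ^{a})` is invertible** (`ϖ ≠ 0`): there is `Z ∈ GL_N(K)` with matrix `diag(ϖ^{a_i})` — so the `∀ Z`-clause of the head is never vacuous. [cite: BruhatTits1972, §10] -/
theorem exists_gl_coe_eq_diagonal_zpow {ϖ : K} (hϖ : ϖ ≠ 0) (a : Fin N → ℤ) :
    ∃ Z : GL (Fin N) K, (Z : Matrix (Fin N) (Fin N) K) = Matrix.diagonal (fun i => ϖ ^ (a i)) := by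
  have hdet : (Matrix.diagonal (fun i => ϖ ^ (a i))).det ≠ 0 := by
    rw [Matrix.det_diagonal]
    exact Finset.prod_ne_zero_iff.2 fun j _ => zpow_ne_zero _ hϖ
  exact ⟨Matrix.GeneralLinearGroup.mkOfDetNeZero _ hdet, rfl⟩

/-! ## §2 Coordinate ideals of a diagonal translate: `pr_i(diag(z)·latt g) = z_i · pr_i(latt g)` -/

/-- `Z·latt g = latt (diag(z) g)` for `Z = diag(z) ∈ GL_N(K)`. [cite: Serre1980Trees, II §1.1] -/
theorem mapGL_latt_eq_latt_diagonal_mul (Z g : GL (Fin N) K) (z : Fin N → K) (hZ : (Z : Matrix (Fin N) (Fin N) K) = Matrix.diagonal z) :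
    mapGL Z (latt (g : Matrix (Fin N) (Fin N) K)) = latt (Matrix.diagonal z * (g : Matrix (Fin N) (Fin N) K)) := by
  rw [mapGL_latt, Units.val_mul, hZ]

/-- **Bound.** If row `i` of `g` has `|g_{ij}| ≤ exp(r)` for all `j`, then every `x ∈ diag(z)·latt g` has `|x_i| ≤ |z_i|·exp(r)` (★ row-ideal bound on the rows `z_i g_{i·}` of
`diag(z) g`). [cite: Serre1980Trees, II §1.1] -/
theorem v_apply_le_of_mem_mapGL_diagonal (Z g : GL (Fin N) K) (z : Fin N → K) (hZ : (Z : Matrix (Fin N) (Fin N) K) = Matrix.diagonal z) (i : Fin N) {r : ℤ}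
    (hr : ∀ j, Valued.v ((g : Matrix (Fin N) (Fin N) K) i j) ≤ WithZero.exp r) {x : Fin N → K} (hx : x ∈ mapGL Z (latt (g : Matrix (Fin N) (Fin N) K))) :
    Valued.v (x i) ≤ Valued.v (z i) * WithZero.exp r := by
  haveI : NeZero N := NeZero.of_pos (Fin.pos i)
  rw [mapGL_latt_eq_latt_diagonal_mul Z g z hZ] at hx
  refine (v_apply_le_sup_of_mem_latt' _ i hx).trans (Finset.sup'_le _ _ fun j _ => ?_)
  rw [Matrix.diagonal_mul, map_mul]
  exact mul_le_mul' le_rfl (hr j)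

/-- **Attainment.** If row `i` of `g` has an entry with `|g_{ij₀}| = exp(r)`, then some `x ∈ diag(z)·latt g` has `|x_i| = |z_i|·exp(r)` (the column `(diag(z) g)·e_{j₀}`).
[cite: Serre1980Trees, II §1.1] -/
theorem exists_mem_mapGL_diagonal_v_apply_eq (Z g : GL (Fin N) K) (z : Fin N → K) (hZ : (Z : Matrix (Fin N) (Fin N) K) = Matrix.diagonal z) (i : Fin N) {r : ℤ}
    (hr : ∃ j, Valued.v ((g : Matrix (Fin N) (Fin N) K) i j) = WithZero.exp r) :
    ∃ x ∈ mapGL Z (latt (g : Matrix (Fin N) (Fin N) K)), Valued.v (x i) = Valued.v (z i) * WithZero.exp r := by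
  obtain ⟨j₀, hj₀⟩ := hr
  rw [mapGL_latt_eq_latt_diagonal_mul Z g z hZ]
  refine ⟨(Matrix.diagonal z * (g : Matrix (Fin N) (Fin N) K)).mulVec (Pi.single j₀ 1), mulVec_single_mem_latt _ j₀, ?_⟩
  rw [Matrix.mulVec_single_one, Matrix.col_apply, Matrix.diagonal_mul, map_mul, hj₀]

/-- **Normalisation criterion at one slot.** For `Z = diag(ϖ^{a})` (`|ϖ| = exp(−1)`): slot `i` of `Z·latt g` is normalised — all `|x_i| ≤ 1` and some `|x_i| = 1`, i.e.
`pr_i(Z·latt g) = 𝒪` — iff `exp(a_i)` is the (attained) row maximum `max_j |g_{ij}|`. [cite: Serre1980Trees, II §1.1] [cite: BruhatTits1972, §10] -/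
theorem normalisedAt_mapGL_diagonal_zpow_iff {ϖ : K} (hϖ : Valued.v ϖ = WithZero.exp (-1 : ℤ)) (g : GL (Fin N) K) (a : Fin N → ℤ) (Z : GL (Fin N) K)
    (hZ : (Z : Matrix (Fin N) (Fin N) K) = Matrix.diagonal (fun i => ϖ ^ (a i))) (i : Fin N) :
    ((∀ x ∈ mapGL Z (latt (g : Matrix (Fin N) (Fin N) K)), Valued.v (x i) ≤ 1) ∧ ∃ x ∈ mapGL Z (latt (g : Matrix (Fin N) (Fin N) K)), Valued.v (x i) = 1) ↔
      ((∀ j, Valued.v ((g : Matrix (Fin N) (Fin N) K) i j) ≤ WithZero.exp (a i)) ∧ ∃ j, Valued.v ((g : Matrix (Fin N) (Fin N) K) i j) = WithZero.exp (a i)) := by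
  have hvz : ∀ b : ℤ, Valued.v (ϖ ^ b) = WithZero.exp (-b) := fun b => by
    rw [map_zpow₀, hϖ, ← WithZero.exp_zsmul, smul_eq_mul, mul_neg, mul_one]
  have hmul : ∀ r : ℤ, Valued.v (ϖ ^ (a i)) * WithZero.exp r = WithZero.exp (r - a i) := fun r => by
    rw [hvz, ← WithZero.exp_add, neg_add_eq_sub]
  obtain ⟨r, hr⟩ := exists_row_exponent g i
  -- the translate attains exactly `exp (r - a i)` at slot `i`
  have hle : ∀ x ∈ mapGL Z (latt (g : Matrix (Fin N) (Fin N) K)), Valued.v (x i) ≤ WithZero.exp (r - a i) := fun x hx =>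
    hmul r ▸ v_apply_le_of_mem_mapGL_diagonal Z g _ hZ i hr.1 hx
  have hat : ∃ x ∈ mapGL Z (latt (g : Matrix (Fin N) (Fin N) K)), Valued.v (x i) = WithZero.exp (r - a i) :=
    hmul r ▸ exists_mem_mapGL_diagonal_v_apply_eq Z g _ hZ i hr.2
  constructor
  · rintro ⟨h1, x, hx, hx1⟩
    obtain ⟨x', hx', hx1'⟩ := hat
    have hra : r = a i := by
      have h2 : WithZero.exp (r - a i) ≤ WithZero.exp (0 : ℤ) := by rw [WithZero.exp_zero, ← hx1']; exact h1 x' hx'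
      have h3 : WithZero.exp (0 : ℤ) ≤ WithZero.exp (r - a i) := by rw [WithZero.exp_zero, ← hx1]; exact hle x hx
      rw [WithZero.exp_le_exp] at h2 h3
      omega
    exact hra ▸ hr
  · intro ha
    refine ⟨fun x hx => ?_, ?_⟩
    · have := v_apply_le_of_mem_mapGL_diagonal Z g _ hZ i ha.1 hx
      rwa [hmul, sub_self, WithZero.exp_zero] at this
    · have := exists_mem_mapGL_diagonal_v_apply_eq Z g _ hZ i ha.2
      rwa [hmul, sub_self, WithZero.exp_zero] at this

/-! ## §3 HEAD — TARGET J «NORMALISATION SECTION» -/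

/-- **«NORMALISATION SECTION»** (MS ROAD-A TARGET J, verbatim): for `|ϖ| = exp(−1)` and `g ∈ GL_N(K)` there is a UNIQUE exponent vector `a ∈ ℤ^N` such that the translate
`diag(ϖ^{a})·latt g` is normalised — every coordinate ideal is exactly `𝒪` (`∀ i`, all `|x_i| ≤ 1` and some `|x_i| = 1`).  Namely `exp(a_i) = max_j |g_{ij}|` (row ideal ★
p855324); so every `ϖ^{ℤ^N}`-orbit of full lattices meets the normalised set exactly once (`𝓛 ∕ ϖ^{ℤ^N} ≅ 𝓛₀`).  The diagonal matrix is quantified def-free as a `GL`-element `Z`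
with prescribed entries (such `Z` exists: `exists_gl_coe_eq_diagonal_zpow`). [cite: Serre1980Trees, II §1.1] [cite: BruhatTits1972, §10] -/
theorem existsUnique_zpow_diagonal_normalised {K : Type*} [Field K] [Valued K ℤᵐ⁰] {N : ℕ} {ϖ : K} (hϖ : Valued.v ϖ = WithZero.exp (-1 : ℤ)) (g : GL (Fin N) K) :
    ∃! a : Fin N → ℤ, ∀ Z : GL (Fin N) K, (Z : Matrix (Fin N) (Fin N) K) = Matrix.diagonal (fun i => ϖ ^ (a i)) →
      ∀ i, (∀ x ∈ mapGL Z (latt (g : Matrix (Fin N) (Fin N) K)), Valued.v (x i) ≤ 1) ∧ ∃ x ∈ mapGL Z (latt (g : Matrix (Fin N) (Fin N) K)), Valued.v (x i) = 1 := by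
  have hϖ0 : ϖ ≠ 0 := by
    intro h
    rw [h, map_zero] at hϖ
    exact WithZero.coe_ne_zero hϖ.symm
  choose r hr using exists_row_exponent g
  refine ⟨r, fun Z hZ i => (normalisedAt_mapGL_diagonal_zpow_iff hϖ g r Z hZ i).2 (hr i), fun a ha => funext fun i => ?_⟩
  obtain ⟨Z, hZ⟩ := exists_gl_coe_eq_diagonal_zpow hϖ0 a
  obtain ⟨-, j, hj⟩ := (normalisedAt_mapGL_diagonal_zpow_iff hϖ g a Z hZ i).1 (ha Z hZ i)
  obtain ⟨hrle, j', hj'⟩ := hr i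
  have h1 : WithZero.exp (a i) ≤ WithZero.exp (r i) := hj ▸ hrle j
  have h2 : WithZero.exp (r i) ≤ WithZero.exp (a i) := hj' ▸ ((normalisedAt_mapGL_diagonal_zpow_iff hϖ g a Z hZ i).1 (ha Z hZ i)).1 j'
  rw [WithZero.exp_le_exp] at h1 h2
  omega

end Summit.HodgeConjecture.HodgeConjecture.Cruxes.H413.F0P3cDyRamDiagonalNormalisedSection

end
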